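import Summits.SmoothPoincare4.SmoothPoincare4.Theses.ConvexBisection
import Literature.Topology.FourManifolds.Gluing
import Literature.Topology.FourManifolds.CerfGammaFourProofs
import HarnessLib

/-!
# `PlanarBisectionRigidity` — negative-side helper: a seam extension makes the bisected manifold
# an honest double (drefute of line `coloured-string-links-square-free-ac`, finding F2)

Crux `Summit.SmoothPoincare4.SmoothPoincare4.Theses.ConvexBisection.PlanarBisectionRigidity`
(stmt-SmoothPoincare4-10511), line `Cruxes/PlanarBisectionRigidity/Lines/coloured-string-links-square-free-ac.lean`,
lever `stub_contractibleHalfDouble` (conclusion `IsDouble (BoundaryManifold.boundaryData 3 W₁) (𝓡 4) M`).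

The line's engine (C2) cancels the 2/3-handles of the relative cobordism `(V_T; X_B, X_A)`; a
cancellation is a PRODUCT structure, so whenever the engine succeeds the seam identification
`ψ = e₂⁻¹ ∘ e₁|∂W₁` extends to a diffeomorphism `F : W₁ → W₂` (paper, drefute note
`Cruxes/PlanarBisectionRigidity/DrefuteStubContractibleHalfDouble.md`, F2).  This file is the formal
CONVERSE bookkeeping: such an extension `F` ALREADY gives the lever's conclusion, with no
5-manifold, no Stein structure, no planarity, no homotopy-sphere hypothesis and no contractibility
— two embeddings `e₁`, `e₂ ∘ F` of `W₁` cover `M` and meet exactly, identically, along `∂W₁`.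
Hence the engine's non-trivial reach is empty: it can only succeed where its output is immediate.

Purely topological; general piece `W₁`, general ambient charted space `M`. [folklore]
-/

noncomputable section

open scoped Manifold ContDiff Topology
open Set Function
open Literature.Topology.FourManifolds

-- the prescribed namespace `Summit.<P>.<Sub>.…` duplicates `SmoothPoincare4` (P = Sub)
set_option linter.dupNamespace false

namespace Summit.SmoothPoincare4.SmoothPoincare4.Theorems.PlanarBisectionRigidity.Negative

universe u

/-- **Seam extension ⇒ honest double.** Let `e₁ : W₁ → M`, `e₂ : W₂ → M` be smooth embeddings
of 4-manifolds with boundary whose ranges cover `M` and meet exactly in `e₁(∂W₁)` (three of the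
crux hypotheses; the Stein/contact/planar/homotopy-sphere hypotheses are not needed).  If the seam
map extends, i.e. there is a diffeomorphism `F : W₁ ≃ₘ W₂` with `e₂ (F w) = e₁ w` for every
boundary point `w` of `W₁`, then `M` is a double of `W₁` in the sense of
`Literature.Topology.FourManifolds.IsDouble` for the canonical boundary datum
`BoundaryManifold.boundaryData 3 W₁`: the embeddings `e₁` and `e₂ ∘ F` cover `M` and
`e₁ a = e₂ (F a′) ↔ a = a′ ∈ ∂W₁`.  This is the conclusion of the line's lever
`stub_contractibleHalfDouble`, obtained from the honest output of its engine in five lines.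
[folklore] -/
theorem isDouble_of_seamExtension
    {M : Type*} [TopologicalSpace M] [ChartedSpace (EuclideanSpace ℝ (Fin 4)) M]
    {W₁ : Type u} [TopologicalSpace W₁] [ChartedSpace (EuclideanHalfSpace 4) W₁]
    [IsManifold (𝓡∂ 4) ∞ W₁]
    {W₂ : Type*} [TopologicalSpace W₂] [ChartedSpace (EuclideanHalfSpace 4) W₂]
    [IsManifold (𝓡∂ 4) ∞ W₂]
    {e₁ : W₁ → M} {e₂ : W₂ → M}
    (he₁ : Manifold.IsSmoothEmbedding (𝓡∂ 4) (𝓡 4) ∞ e₁)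
    (he₂ : Manifold.IsSmoothEmbedding (𝓡∂ 4) (𝓡 4) ∞ e₂)
    (hcover : range e₁ ∪ range e₂ = univ)
    (hseam₁ : range e₁ ∩ range e₂ = e₁ '' (𝓡∂ 4).boundary W₁)
    (F : W₁ ≃ₘ⟮𝓡∂ 4, 𝓡∂ 4⟯ W₂)
    (hF : ∀ w ∈ (𝓡∂ 4).boundary W₁, e₂ (F w) = e₁ w) :
    IsDouble (BoundaryManifold.boundaryData 3 W₁) (𝓡 4) M := by
  refine ⟨e₁, e₂ ∘ F, he₁, he₂.comp_diffeomorph F, ?_, fun a a' => ?_⟩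
  · rw [(EquivLike.surjective F).range_comp]
    exact hcover
  · simp only [BoundaryManifold.boundaryData_incl, comp_apply, id_eq]
    constructor
    · intro h
      have ha : e₁ a ∈ range e₁ ∩ range e₂ := ⟨mem_range_self a, F a', h.symm⟩
      rw [hseam₁] at ha
      obtain ⟨a₀, ha₀, hEq⟩ := ha
      obtain rfl : a₀ = a := he₁.isEmbedding.injective hEq
      have h2 : e₂ (F a') = e₂ (F a₀) := by rw [← h, hF a₀ ha₀]
      have h3 : a' = a₀ := EquivLike.injective F (he₂.isEmbedding.injective h2)
      exact ⟨⟨a₀, ha₀⟩, rfl, h3⟩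
    · rintro ⟨z, rfl, rfl⟩
      exact (hF z.1 z.2).symm

/-- **The same, packaged against the crux data verbatim** (the hypotheses of
`stub_contractibleHalfDouble` minus everything the argument does not use, plus the seam extension
`F`): for the record that the lever's conclusion `IsDouble (∂W₁) (𝓡 4) M` follows from a seam
extension alone. [folklore] -/
theorem stub_contractibleHalfDouble_of_seamExtension
    (M : Type) [TopologicalSpace M] [ChartedSpace (EuclideanSpace ℝ (Fin 4)) M]
    (W₁ : Type) [TopologicalSpace W₁] [ChartedSpace (EuclideanHalfSpace 4) W₁]
    [IsManifold (𝓡∂ 4) ∞ W₁]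
    (W₂ : Type) [TopologicalSpace W₂] [ChartedSpace (EuclideanHalfSpace 4) W₂]
    [IsManifold (𝓡∂ 4) ∞ W₂] (e₁ : W₁ → M) (e₂ : W₂ → M)
    (he₁ : Manifold.IsSmoothEmbedding (𝓡∂ 4) (𝓡 4) ∞ e₁)
    (he₂ : Manifold.IsSmoothEmbedding (𝓡∂ 4) (𝓡 4) ∞ e₂)
    (hcover : range e₁ ∪ range e₂ = univ)
    (hseam₁ : range e₁ ∩ range e₂ = e₁ '' (𝓡∂ 4).boundary W₁)
    (hext : ∃ F : W₁ ≃ₘ⟮𝓡∂ 4, 𝓡∂ 4⟯ W₂, ∀ w ∈ (𝓡∂ 4).boundary W₁, e₂ (F w) = e₁ w) :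
    IsDouble (BoundaryManifold.boundaryData 3 W₁) (𝓡 4) M := by
  obtain ⟨F, hF⟩ := hext
  exact isDouble_of_seamExtension he₁ he₂ hcover hseam₁ F hF

end Summit.SmoothPoincare4.SmoothPoincare4.Theorems.PlanarBisectionRigidity.Negative

end
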